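import Summits.AnomalousDissipation.AnomalousDissipation.Theorems.SawtoothPulseCascadeK1LocalisedCascadePhaseOneAmplitude
import Summits.AnomalousDissipation.AnomalousDissipation.Theorems.SawtoothPulseCascadeK1LocalisedCascadePhaseOneFibreTable

/-!
# K1loc, line `Spectral` / thin start — helper: THE PHASE-ONE T-H JUNK, ONE FIBRE AT A TIME («PhaseOneHFibre», D4 frame)

Helper file of the prover lane on the crux `K1LocalisedCascade` (stmt-AnomalousDissipation-19491), route `SawtoothPulseCascade`
(glue seat; arbiter A24-2 (2); plan `PHASE1-DIRECT-SIZING-k1locp3g4.md` §4).  The T-H junk of phase 1 is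
`j_H = Σ'[20 ≤ |k₀| ∧ |k₁| < K′]‖𝓕b₁‖²`, `b₁ = a₁ ∘ Φ_H(ψ₁)`; on the fibre `k₀ = n` the per-fibre Minkowski bound of `…FibreMinkowski`
with the sources `1 ≤ |q| ≤ Q_c` treated one by one and the rest in `ℓ²` reads, after inserting the rational amplitude table `Ā`
of `…PhaseOneAmplitude`, the two-piece window mass of `…ChirpWindowMass` for the sources `|q| ≤ Q₁` (window `|m − q| ≤ K′ − 1 + Q₁`
below the lobe `8|n|`) and the trivial mass `≤ 1` for `Q₁ < |q| ≤ Q_c`: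
* **`phaseOne_hfibre_sqrt_le`**:
  `√(Σ_{|m|<K′} ‖𝓕b₁(n,m)‖²) ≤ 2(s + 2⁻²⁷|n|)·Σ_{q=1}^{Q₁} Ā(n,q) + 2·Σ_{q=Q₁+1}^{Q_c} Ā(n,q) + √(Σ'_{q : ¬(1 ≤ |q| ≤ Q_c)} ‖𝓕a₁(n,q)‖²)`
  for every `s ≥ 0` with `s² ≥` the rational window-mass bound `Bw(n; K₁, K)` — the numeric side conditions
  (`K₁ ≤ K`, `4K < 8|n|`, `K′ + Q₁ ≤ 4K − 1`, `Bw ≤ s²`) are what the generated per-fibre files discharge by `norm_num`;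
* `abar_neg`: the table is even in `q` (so only `q ≥ 1` is evaluated); `norm_mFourierCoeff_hfibre_neg`: `X(−n) = X(n)` for the
  symmetric window (real iterates have Hermitian coefficients).
No definitions; nothing about the crux. [cite: Grafakos2014, Prop. 3.1.2 (5), Prop. 3.2.7 (3)] [problem: turb]
-/

-- `Summit.<Summit>.<Problem>`: single-conjunct summit, the duplicate namespace segment is deliberate.
set_option linter.dupNamespace false

noncomputable section

namespace Summit.AnomalousDissipation.AnomalousDissipation.Theorems.SawtoothPulseCascade.K1Start

open MeasureTheory Filter Topology UnitAddTorus Complex AddCircle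
open scoped Real
open Literature.Analysis Literature.Analysis.FunctionSpaces Literature.Analysis.FunctionSpaces.Torus Literature.Analysis.FluidPDE
open Literature.Analysis.FluidPDE.ShearStage
open Literature.Analysis.FluidPDE.SawtoothCascade Literature.Analysis.FluidPDE.SawtoothCascade.CascadeParams
open Summit.AnomalousDissipation.AnomalousDissipation.Theorems.SawtoothPulseCascade.K1Window

/-! ## §1 Bookkeeping: Hermitian symmetry, shifted windows, the source set -/

/-- Coefficients of a real function are Hermitian in norm: `‖𝓕g(−k)‖ = ‖𝓕g(k)‖`. [folklore] -/
theorem norm_mFourierCoeff_neg_real (g : UnitAddTorus (Fin 2) → ℝ) (k : Fin 2 → ℤ) :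
    ‖mFourierCoeff (fun x => (g x : ℂ)) (-k)‖ = ‖mFourierCoeff (fun x => (g x : ℂ)) k‖ := by
  have h : mFourierCoeff (fun x => (g x : ℂ)) (-k) = starRingEnd ℂ (mFourierCoeff (fun x => (g x : ℂ)) k) := by
    rw [mFourierCoeff_eq_integral_volume, mFourierCoeff_eq_integral_volume, ← integral_conj]
    refine integral_congr_ae (Eventually.of_forall fun x => ?_)
    simp only [neg_neg, smul_eq_mul, map_mul, Complex.conj_ofReal, mFourier_neg, RingHomCompTriple.comp_apply,
      RingHom.id_apply]
  rw [h, Complex.norm_conj]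

/-- **The fibre window is even in the fibre index**: for real `g` and `K′`,
`Σ_{|m|<K′} ‖𝓕g(−n, m)‖² = Σ_{|m|<K′} ‖𝓕g(n, m)‖²`. [folklore] -/
theorem sum_window_sq_norm_hfibre_neg (g : UnitAddTorus (Fin 2) → ℝ) (Kp : ℕ) (n : ℤ) :
    ∑ m ∈ Finset.Ioo (-(Kp : ℤ)) Kp, ‖mFourierCoeff (fun x => (g x : ℂ)) ![-n, m]‖ ^ 2 =
      ∑ m ∈ Finset.Ioo (-(Kp : ℤ)) Kp, ‖mFourierCoeff (fun x => (g x : ℂ)) ![n, m]‖ ^ 2 := by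
  have h1 : ∀ m, ‖mFourierCoeff (fun x => (g x : ℂ)) ![-n, m]‖ = ‖mFourierCoeff (fun x => (g x : ℂ)) ![n, -m]‖ := by
    intro m
    rw [← norm_mFourierCoeff_neg_real g ![n, -m]]
    congr 2
    ext i; fin_cases i <;> simp
  simp_rw [h1]
  refine Finset.sum_nbij' (fun m => -m) (fun m => -m) ?_ ?_ (fun m _ => neg_neg m) (fun m _ => neg_neg m) (fun m _ => rfl)
  · intro m hm; rw [Finset.mem_Ioo] at hm ⊢; omega
  · intro m hm; rw [Finset.mem_Ioo] at hm ⊢; omega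

/-- A shifted window `{m − q : |m| < K′}` lies in `[−(4K−2), 4K−2]` once `K′ + Q₁ ≤ 4K − 1` and `|q| ≤ Q₁`. [folklore] -/
theorem shifted_window_bound {Kp Q₁ K : ℕ} (hwin : Kp + Q₁ + 1 ≤ 4 * K) {q : ℤ} (hq : |q| ≤ Q₁)
    (m : ℤ) (hm : m ∈ (Finset.Ioo (-(Kp : ℤ)) Kp).image (fun m => m - q)) : |m| ≤ 4 * (K : ℤ) - 2 := by
  rw [Finset.mem_image] at hm
  obtain ⟨m', hm', rfl⟩ := hm
  rw [Finset.mem_Ioo] at hm'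
  have h1 : |m' - q| ≤ |m'| + |q| := abs_sub _ _
  have h2 : |m'| ≤ Kp - 1 := by rw [abs_le]; omega
  have h3 : ((Kp : ℕ) : ℤ) + Q₁ + 1 ≤ 4 * K := by exact_mod_cast hwin
  linarith

/-- The window sum of a shifted sequence is the sum over the shifted window. [folklore] -/
theorem sum_window_shift_eq (f : ℤ → ℝ) (W : Finset ℤ) (q : ℤ) :
    ∑ m ∈ W, f (m - q) = ∑ m ∈ W.image (fun m => m - q), f m := by
  rw [Finset.sum_image fun a _ b _ h => by simpa using h]

/-! ## §2 The rational amplitude table is even in the source index -/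

/-- **`Ā(n, −q) = Ā(n, q)`** (the rational table of `…PhaseOneAmplitude` depends on `q` through `|q|`, `q²`, `q mod 2` and `{±8q}`).
[folklore] -/
theorem abar_neg (n q : ℤ) :
    1 / 2 * ((if -q = 8 ∨ -q = -8 then (1 / 2 : ℝ) else if (-q) % 2 = 0 then 0 else 16 * 0.31831 / |64 - ((-q : ℤ) : ℝ) ^ 2|) +
          (2 : ℝ)⁻¹ ^ 25) *
        ((if 8 * (-q) + (n + 1) = 0 ∨ 8 * (-q) - (n + 1) = 0 then (1 / 2 : ℝ) else if (n + 1) % 2 = 0 then 0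
            else 16 * |((-q : ℤ) : ℝ)| * 0.31831 / |64 * ((-q : ℤ) : ℝ) ^ 2 - ((n + 1 : ℤ) : ℝ) ^ 2|) +
          (if 8 * (-q) + (n - 1) = 0 ∨ 8 * (-q) - (n - 1) = 0 then (1 / 2 : ℝ) else if (n - 1) % 2 = 0 then 0
            else 16 * |((-q : ℤ) : ℝ)| * 0.31831 / |64 * ((-q : ℤ) : ℝ) ^ 2 - ((n - 1 : ℤ) : ℝ) ^ 2|) +
          2 * |((-q : ℤ) : ℝ)| * (2 : ℝ)⁻¹ ^ 25) =
    1 / 2 * ((if q = 8 ∨ q = -8 then (1 / 2 : ℝ) else if q % 2 = 0 then 0 else 16 * 0.31831 / |64 - (q : ℝ) ^ 2|) +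
          (2 : ℝ)⁻¹ ^ 25) *
        ((if 8 * q + (n + 1) = 0 ∨ 8 * q - (n + 1) = 0 then (1 / 2 : ℝ) else if (n + 1) % 2 = 0 then 0
            else 16 * |(q : ℝ)| * 0.31831 / |64 * (q : ℝ) ^ 2 - ((n + 1 : ℤ) : ℝ) ^ 2|) +
          (if 8 * q + (n - 1) = 0 ∨ 8 * q - (n - 1) = 0 then (1 / 2 : ℝ) else if (n - 1) % 2 = 0 then 0
            else 16 * |(q : ℝ)| * 0.31831 / |64 * (q : ℝ) ^ 2 - ((n - 1 : ℤ) : ℝ) ^ 2|) +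
          2 * |(q : ℝ)| * (2 : ℝ)⁻¹ ^ 25) := by
  have e1 : (-q = 8 ∨ -q = -8) ↔ (q = 8 ∨ q = -8) := by omega
  have e2 : ((-q) % 2 = 0) ↔ (q % 2 = 0) := by omega
  have e3 : ∀ m : ℤ, (8 * (-q) + m = 0 ∨ 8 * (-q) - m = 0) ↔ (8 * q + m = 0 ∨ 8 * q - m = 0) := fun m => by omega
  have e4 : ((-q : ℤ) : ℝ) ^ 2 = (q : ℝ) ^ 2 := by push_cast; ring
  have e5 : |((-q : ℤ) : ℝ)| = |(q : ℝ)| := by push_cast; rw [abs_neg]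
  simp only [e1, e2, e3, e4, e5]

/-! ## §3 The per-fibre bound -/

section Cascade

variable (P : CascadeParams)

set_option maxHeartbeats 800000 in
/-- **THE PHASE-ONE T-H JUNK ON ONE FIBRE** (see the file header): `γ = 8`, `N₀ = 1`, `ρN = 2`, `d = 2`, `0 < δ₀ ≤ 2⁻³⁰`; fibre `n ≠ 0`,
window `|m| < K′`, Minkowski sources `1 ≤ |q| ≤ Q_c` (two-piece window mass `s` for `|q| ≤ Q₁`, mass `≤ 1` beyond), `ℓ²` remainder
`ρ_n = √(Σ'_{¬(1 ≤ |q| ≤ Q_c)} ‖𝓕a₁(n,q)‖²)`: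
`√(Σ_{|m|<K′} ‖𝓕b₁(n,m)‖²) ≤ 2(s + 2⁻²⁷|n|)·Σ_{q=1}^{Q₁} Ā(n,q) + 2·Σ_{q=Q₁+1}^{Q_c} Ā(n,q) + ρ_n`.
[cite: Grafakos2014, Prop. 3.1.2 (5), Prop. 3.2.7 (3)] -/
theorem phaseOne_hfibre_sqrt_le (hγ : P.γ = 8) (hN₀ : P.N₀ = 1) (hρN : P.ρN = 2) (hd : P.d = 2) (hδ₀ : 0 < P.δ₀)
    (hδ₀' : P.δ₀ ≤ (2 : ℝ)⁻¹ ^ 30) (a b : ℕ → UnitAddTorus (Fin 2) → ℝ) (h0 : a 0 = datum)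
    (hb : ∀ j, b j = a j ∘ shearMap 0 1 (amp ⟨P.U j, P.U_periodic j, P.contDiff_U (P.δ_pos hδ₀ (by rw [hd]; norm_num) j)⟩ P.γ))
    (hab : ∀ j, a (j + 1) = b j ∘ shearMap 1 0 (amp ⟨P.U j, P.U_periodic j, P.contDiff_U (P.δ_pos hδ₀ (by rw [hd]; norm_num) j)⟩ P.γ))
    (Kp Qc Q₁ K₁ K : ℕ) {n : ℤ} (hn : n ≠ 0) (hQ : Q₁ ≤ Qc) (hK₁ : K₁ ≤ K) (hK : 4 * (K : ℝ) < 8 * |(n : ℝ)|)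
    (hwin : Kp + Q₁ + 1 ≤ 4 * K) {s : ℝ} (hs0 : 0 ≤ s)
    (hs : 2 * (32 * |(n : ℝ)| * 0.31831) ^ 2 * (1 / 4 * ((1 / (8 * |(n : ℝ)|)) ^ 2 * (1 / (8 * |(n : ℝ)| - 4 * K₁) - 1 / (8 * |(n : ℝ)|)) +
        (1 / (8 * |(n : ℝ)| + 4 * K₁ + 2)) ^ 2 * (1 / (8 * |(n : ℝ)| - 4 * K) - 1 / (8 * |(n : ℝ)| - 4 * K₁)))) ≤ s ^ 2) :
    Real.sqrt (∑ m ∈ Finset.Ioo (-(Kp : ℤ)) Kp, ‖mFourierCoeff (fun x => (b 1 x : ℂ)) ![n, m]‖ ^ 2) ≤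
      2 * (s + (2 : ℝ)⁻¹ ^ 27 * |(n : ℝ)|) * ∑ q ∈ Finset.Icc (1 : ℤ) Q₁,
          1 / 2 * ((if q = 8 ∨ q = -8 then (1 / 2 : ℝ) else if q % 2 = 0 then 0 else 16 * 0.31831 / |64 - (q : ℝ) ^ 2|) +
              (2 : ℝ)⁻¹ ^ 25) *
            ((if 8 * q + (n + 1) = 0 ∨ 8 * q - (n + 1) = 0 then (1 / 2 : ℝ) else if (n + 1) % 2 = 0 then 0
                else 16 * |(q : ℝ)| * 0.31831 / |64 * (q : ℝ) ^ 2 - ((n + 1 : ℤ) : ℝ) ^ 2|) +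
              (if 8 * q + (n - 1) = 0 ∨ 8 * q - (n - 1) = 0 then (1 / 2 : ℝ) else if (n - 1) % 2 = 0 then 0
                else 16 * |(q : ℝ)| * 0.31831 / |64 * (q : ℝ) ^ 2 - ((n - 1 : ℤ) : ℝ) ^ 2|) +
              2 * |(q : ℝ)| * (2 : ℝ)⁻¹ ^ 25) +
        2 * ∑ q ∈ Finset.Ioc (Q₁ : ℤ) Qc,
          1 / 2 * ((if q = 8 ∨ q = -8 then (1 / 2 : ℝ) else if q % 2 = 0 then 0 else 16 * 0.31831 / |64 - (q : ℝ) ^ 2|) +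
              (2 : ℝ)⁻¹ ^ 25) *
            ((if 8 * q + (n + 1) = 0 ∨ 8 * q - (n + 1) = 0 then (1 / 2 : ℝ) else if (n + 1) % 2 = 0 then 0
                else 16 * |(q : ℝ)| * 0.31831 / |64 * (q : ℝ) ^ 2 - ((n + 1 : ℤ) : ℝ) ^ 2|) +
              (if 8 * q + (n - 1) = 0 ∨ 8 * q - (n - 1) = 0 then (1 / 2 : ℝ) else if (n - 1) % 2 = 0 then 0
                else 16 * |(q : ℝ)| * 0.31831 / |64 * (q : ℝ) ^ 2 - ((n - 1 : ℤ) : ℝ) ^ 2|) +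
              2 * |(q : ℝ)| * (2 : ℝ)⁻¹ ^ 25) +
        Real.sqrt (∑' q : ℤ, if 1 ≤ |q| ∧ |q| ≤ (Qc : ℤ) then 0 else ‖mFourierCoeff (fun x => (a 1 x : ℂ)) ![n, q]‖ ^ 2) := by
  classical
  have hπ : 0 < π := Real.pi_pos
  have hd0 : 0 < P.d := by rw [hd]; norm_num
  -- abbreviations for the table
  set A : ℤ → ℝ := fun q =>
    1 / 2 * ((if q = 8 ∨ q = -8 then (1 / 2 : ℝ) else if q % 2 = 0 then 0 else 16 * 0.31831 / |64 - (q : ℝ) ^ 2|) +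
        (2 : ℝ)⁻¹ ^ 25) *
      ((if 8 * q + (n + 1) = 0 ∨ 8 * q - (n + 1) = 0 then (1 / 2 : ℝ) else if (n + 1) % 2 = 0 then 0
          else 16 * |(q : ℝ)| * 0.31831 / |64 * (q : ℝ) ^ 2 - ((n + 1 : ℤ) : ℝ) ^ 2|) +
        (if 8 * q + (n - 1) = 0 ∨ 8 * q - (n - 1) = 0 then (1 / 2 : ℝ) else if (n - 1) % 2 = 0 then 0
          else 16 * |(q : ℝ)| * 0.31831 / |64 * (q : ℝ) ^ 2 - ((n - 1 : ℤ) : ℝ) ^ 2|) +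
        2 * |(q : ℝ)| * (2 : ℝ)⁻¹ ^ 25) with hA
  have hAneg : ∀ q, A (-q) = A q := fun q => by simp only [hA]; exact abar_neg n q
  have hA0 : ∀ q, 0 ≤ A q := fun q => by
    simp only [hA]
    have h1 : 0 ≤ (if q = 8 ∨ q = -8 then (1 / 2 : ℝ) else if q % 2 = 0 then 0 else 16 * 0.31831 / |64 - (q : ℝ) ^ 2|) := by
      split_ifs <;> positivity
    have h2 : ∀ m : ℤ, 0 ≤ (if 8 * q + m = 0 ∨ 8 * q - m = 0 then (1 / 2 : ℝ) else if m % 2 = 0 then 0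
        else 16 * |(q : ℝ)| * 0.31831 / |64 * (q : ℝ) ^ 2 - (m : ℝ) ^ 2|) := fun m => by split_ifs <;> positivity
    have h3 := h2 (n + 1)
    have h4 := h2 (n - 1)
    push_cast at h3 h4
    positivity
  -- the iterates
  set ψ₀ : ShearProfile := amp ⟨P.U 0, P.U_periodic 0, P.contDiff_U (P.δ_pos hδ₀ hd0 0)⟩ P.γ with hψ₀
  set ψ₁ : ShearProfile := amp ⟨P.U 1, P.U_periodic 1, P.contDiff_U (P.δ_pos hδ₀ hd0 1)⟩ P.γ with hψ₁
  have hb0 : b 0 = datum ∘ shearMap 0 1 ψ₀ := by rw [hb 0, h0]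
  have ha1 : a 1 = b 0 ∘ shearMap 1 0 ψ₀ := hab 0
  have ha1s : IsSmooth (a 1) := by
    rw [ha1, hb0]; exact (isSmooth_datum_comp_shearMap ψ₀).comp_shearMap 1 0 ψ₀
  have ha1c : Continuous fun x => (a 1 x : ℂ) := Complex.continuous_ofReal.comp ha1s.continuous
  have ha1sum : Summable fun k => ‖mFourierCoeff (fun x => (a 1 x : ℂ)) k‖ :=
    summable_norm_mFourierCoeff_ofReal_of_isSmooth ha1s
  have hb1 : (fun x => (b 1 x : ℂ)) = (fun x => (a 1 x : ℂ)) ∘ shearMap 0 1 ψ₁ := by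
    rw [hb 1]; rfl
  -- amplitudes
  have hamp : ∀ q : ℤ, q ≠ 0 → ‖mFourierCoeff (fun x => (a 1 x : ℂ)) ![n, q]‖ ≤ A q := fun q hq => by
    simp only [hA]
    exact phaseOne_amplitude_le_rat P hγ hN₀ hδ₀ hδ₀' hd0 a b h0 (hb 0) (hab 0) n hq
  -- the source set
  set Sp : Finset ℤ := Finset.Icc (1 : ℤ) Qc with hSp
  set Sm : Finset ℤ := Sp.image (fun q => -q) with hSm
  set S : Finset ℤ := Sp ∪ Sm with hS
  have hmemS : ∀ q : ℤ, q ∈ S ↔ 1 ≤ |q| ∧ |q| ≤ (Qc : ℤ) := by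
    intro q
    rw [hS, Finset.mem_union, hSm, Finset.mem_image, hSp]
    constructor
    · rintro (h | ⟨q', hq', rfl⟩)
      · rw [Finset.mem_Icc] at h; rw [abs_of_pos (by omega)]; exact h
      · rw [Finset.mem_Icc] at hq'; rw [abs_neg, abs_of_pos (by omega)]; exact hq'
    · rintro ⟨h1, h2⟩
      rcases le_or_gt 0 q with h | h
      · left; rw [Finset.mem_Icc]; rw [abs_of_nonneg h] at h1 h2; exact ⟨h1, h2⟩
      · right; refine ⟨-q, ?_, neg_neg q⟩; rw [Finset.mem_Icc]; rw [abs_of_neg h] at h1 h2; omega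
  have hdisj : Disjoint Sp Sm := by
    rw [Finset.disjoint_left]
    intro q hq hq'
    rw [hSp, Finset.mem_Icc] at hq
    rw [hSm, Finset.mem_image] at hq'
    obtain ⟨q', hq'', rfl⟩ := hq'
    rw [hSp, Finset.mem_Icc] at hq''
    omega
  -- per-fibre Minkowski
  set W : Finset ℤ := Finset.Ioo (-(Kp : ℤ)) Kp with hW
  have hM := sqrt_window_sq_norm_hstep_le ha1c ha1sum ψ₁ n S W
  rw [← hb1] at hM
  -- the remainder indicator
  have hrem : (∑' q : ℤ, if q ∈ S then 0 else ‖mFourierCoeff (fun x => (a 1 x : ℂ)) ![n, q]‖ ^ 2) =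
      ∑' q : ℤ, if 1 ≤ |q| ∧ |q| ≤ (Qc : ℤ) then 0 else ‖mFourierCoeff (fun x => (a 1 x : ℂ)) ![n, q]‖ ^ 2 :=
    tsum_congr fun q => by simp only [hmemS]
  rw [hrem] at hM
  refine hM.trans (add_le_add ?_ le_rfl)
  -- the exact two-tooth chirp of fibre `n` and the rounding of `ψ₁`
  set g₀ : UnitAddCircle → ℂ := (periodic_exactChirpFun 2 (8 * n)).lift with hg₀
  have hg₀c : Continuous g₀ := (continuous_exactChirp_lift 2 (8 * n)).1
  have hg₀t : ∀ t : ℝ, g₀ (t : UnitAddCircle) =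
      Complex.exp (-(2 * π * I * ((8 * n : ℤ)) * ((tri (2 * π * (2 : ℕ) * t) / (2 * π * (2 : ℕ)) : ℝ) : ℂ))) :=
    fun t => (continuous_exactChirp_lift 2 (8 * n)).2 t
  have hg₀f : ∀ t : ℝ, g₀ (t : UnitAddCircle) =
      cexp (-(2 * π * I * ((((8 * n : ℤ) : ℝ) * (tri (2 * π * (2 : ℕ) * t) / (2 * π * (2 : ℕ))) : ℝ) : ℂ))) := by
    intro t; rw [hg₀t t]; push_cast; ring_nf
  have hnear : ∀ t : ℝ, |n * ψ₁ t - ((8 * n : ℤ) : ℝ) * (tri (2 * π * (2 : ℕ) * t) / (2 * π * (2 : ℕ)))| ≤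
      |(n : ℝ)| * ((2 * Real.exp (1 / 2) - 1) * P.δ₀ / π) := fun t => by
    rw [hψ₁]; exact phaseOne_profile_near P hγ hN₀ hρN hd hδ₀ n t
  have hround : 2 * π * (|(n : ℝ)| * ((2 * Real.exp (1 / 2) - 1) * P.δ₀ / π)) ≤ (2 : ℝ)⁻¹ ^ 27 * |(n : ℝ)| :=
    phaseOne_rounding_le hδ₀.le hδ₀' n
  -- window masses: `≤ s + 2⁻²⁷|n|` for `|q| ≤ Q₁`, `≤ 1` always
  have hmass1 : ∀ q : ℤ, Real.sqrt (∑ m ∈ W, ‖fourierCoeff (twist ψ₁ n) (m - q)‖ ^ 2) ≤ 1 := by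
    intro q
    rw [sum_window_shift_eq (fun m => ‖fourierCoeff (twist ψ₁ n) m‖ ^ 2) W q]
    have h := sum_window_sq_norm_twist_le_one ψ₁ n (W.image fun m => m - q)
    calc Real.sqrt (∑ m ∈ W.image (fun m => m - q), ‖fourierCoeff (twist ψ₁ n) m‖ ^ 2) ≤ Real.sqrt 1 :=
          Real.sqrt_le_sqrt h
      _ = 1 := Real.sqrt_one
  have hmassQ : ∀ q : ℤ, |q| ≤ Q₁ →
      Real.sqrt (∑ m ∈ W, ‖fourierCoeff (twist ψ₁ n) (m - q)‖ ^ 2) ≤ s + (2 : ℝ)⁻¹ ^ 27 * |(n : ℝ)| := by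
    intro q hq
    have h1 := sqrt_window_shift_twist_le ψ₁ n q hg₀f hg₀c hnear W
    have h2 : Real.sqrt (∑ m ∈ W, ‖fourierCoeff g₀ (m - q)‖ ^ 2) ≤ s := by
      rw [sum_window_shift_eq (fun m => ‖fourierCoeff g₀ m‖ ^ 2) W q]
      have hWb : ∀ m, m ∈ W.image (fun m => m - q) → |m| ≤ 4 * (K : ℤ) - 2 :=
        fun m hm => shifted_window_bound hwin hq m hm
      have h3 := sum_window_sq_norm_twoTooth_le hn hg₀t (lam := 8 * |(n : ℝ)|) rfl hK₁ hK (W.image fun m => m - q) hWb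
      have hϖ : (32 * |(n : ℝ)| / π) ^ 2 ≤ (32 * |(n : ℝ)| * 0.31831) ^ 2 := by
        have h4 : 32 * |(n : ℝ)| / π ≤ 32 * |(n : ℝ)| * 0.31831 := by
          rw [div_eq_mul_one_div]
          exact mul_le_mul_of_nonneg_left inv_pi_le_d5 (by positivity)
        exact pow_le_pow_left₀ (by positivity) h4 2
      have hn8 : 0 < 8 * |(n : ℝ)| - 4 * K := by linarith
      have hK₁r : 4 * (K₁ : ℝ) ≤ 4 * K := by exact_mod_cast Nat.mul_le_mul_left 4 hK₁
      have hbr0 : 0 ≤ 1 / 4 * ((1 / (8 * |(n : ℝ)|)) ^ 2 * (1 / (8 * |(n : ℝ)| - 4 * K₁) - 1 / (8 * |(n : ℝ)|)) +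
          (1 / (8 * |(n : ℝ)| + 4 * K₁ + 2)) ^ 2 * (1 / (8 * |(n : ℝ)| - 4 * K) - 1 / (8 * |(n : ℝ)| - 4 * K₁))) := by
        have hn0 : 0 < 8 * |(n : ℝ)| := by linarith [(by positivity : (0 : ℝ) ≤ 4 * K)]
        have hn1 : 0 < 8 * |(n : ℝ)| - 4 * K₁ := by linarith
        have e1 : 0 ≤ 1 / (8 * |(n : ℝ)| - 4 * K₁) - 1 / (8 * |(n : ℝ)|) := by
          rw [sub_nonneg]; exact one_div_le_one_div_of_le hn1 (by linarith [(by positivity : (0 : ℝ) ≤ 4 * K₁)])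
        have e2 : 0 ≤ 1 / (8 * |(n : ℝ)| - 4 * K) - 1 / (8 * |(n : ℝ)| - 4 * K₁) := by
          rw [sub_nonneg]; exact one_div_le_one_div_of_le hn8 (by linarith)
        positivity
      have h5 : ∑ m ∈ W.image (fun m => m - q), ‖fourierCoeff g₀ m‖ ^ 2 ≤ s ^ 2 :=
        h3.trans ((mul_le_mul_of_nonneg_right (mul_le_mul_of_nonneg_left hϖ (by norm_num)) hbr0).trans hs)
      calc Real.sqrt (∑ m ∈ W.image (fun m => m - q), ‖fourierCoeff g₀ m‖ ^ 2) ≤ Real.sqrt (s ^ 2) := Real.sqrt_le_sqrt h5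
        _ = s := Real.sqrt_sq hs0
    linarith
  -- bound the Minkowski sum termwise and fold `±q`
  have hsr0 : 0 ≤ s + (2 : ℝ)⁻¹ ^ 27 * |(n : ℝ)| := by positivity
  have hterm : ∀ q ∈ S, ‖mFourierCoeff (fun x => (a 1 x : ℂ)) ![n, q]‖ *
      Real.sqrt (∑ m ∈ W, ‖fourierCoeff (twist ψ₁ n) (m - q)‖ ^ 2) ≤
      (if |q| ≤ (Q₁ : ℤ) then (s + (2 : ℝ)⁻¹ ^ 27 * |(n : ℝ)|) * A q else A q) := by
    intro q hq
    have hq0 : q ≠ 0 := by have := (hmemS q).1 hq; intro h; rw [h] at this; simp at this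
    have h1 := hamp q hq0
    split_ifs with hq1
    · calc _ ≤ A q * (s + (2 : ℝ)⁻¹ ^ 27 * |(n : ℝ)|) := mul_le_mul h1 (hmassQ q hq1) (Real.sqrt_nonneg _) (hA0 q)
        _ = _ := mul_comm _ _
    · calc _ ≤ A q * 1 := mul_le_mul h1 (hmass1 q) (Real.sqrt_nonneg _) (hA0 q)
        _ = A q := mul_one _
  refine (Finset.sum_le_sum hterm).trans (le_of_eq ?_)
  -- evaluate the folded sums
  set F : ℤ → ℝ := fun q => if |q| ≤ (Q₁ : ℤ) then (s + (2 : ℝ)⁻¹ ^ 27 * |(n : ℝ)|) * A q else A q with hF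
  have hFneg : ∀ q, F (-q) = F q := fun q => by simp only [hF, abs_neg, hAneg]
  have hsumS : ∑ q ∈ S, F q = 2 * ∑ q ∈ Sp, F q := by
    rw [hS, Finset.sum_union hdisj, hSm, Finset.sum_image fun a _ b _ h => by simpa using h]
    simp only [hFneg]
    ring
  have hSp_split : ∑ q ∈ Sp, F q = (s + (2 : ℝ)⁻¹ ^ 27 * |(n : ℝ)|) * ∑ q ∈ Finset.Icc (1 : ℤ) Q₁, A q +
      ∑ q ∈ Finset.Ioc (Q₁ : ℤ) Qc, A q := by
    have hunion : Sp = Finset.Icc (1 : ℤ) Q₁ ∪ Finset.Ioc (Q₁ : ℤ) Qc := by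
      ext q; rw [hSp, Finset.mem_union, Finset.mem_Icc, Finset.mem_Icc, Finset.mem_Ioc]; omega
    have hdisj' : Disjoint (Finset.Icc (1 : ℤ) Q₁) (Finset.Ioc (Q₁ : ℤ) Qc) := by
      rw [Finset.disjoint_left]; intro q h1 h2; rw [Finset.mem_Icc] at h1; rw [Finset.mem_Ioc] at h2; omega
    rw [hunion, Finset.sum_union hdisj', Finset.mul_sum]
    congr 1
    · refine Finset.sum_congr rfl fun q hq => ?_
      rw [Finset.mem_Icc] at hq
      simp only [hF, if_pos (show |q| ≤ (Q₁ : ℤ) by rw [abs_of_pos (by omega)]; exact hq.2)]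
    · refine Finset.sum_congr rfl fun q hq => ?_
      rw [Finset.mem_Ioc] at hq
      simp only [hF, if_neg (show ¬ |q| ≤ (Q₁ : ℤ) by rw [abs_of_pos (by omega)]; omega)]
  change ∑ q ∈ S, F q = _
  rw [hsumS, hSp_split]
  simp only [hA]
  ring

end Cascade

end Summit.AnomalousDissipation.AnomalousDissipation.Theorems.SawtoothPulseCascade.K1Start
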